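import Literature.AlgebraicGeometry.Frobenioids.Prop55Sub
import Literature.AlgebraicGeometry.Frobenioids.ModelFrobenioidBaseSectionSkeleton
import Literature.AlgebraicGeometry.Frobenioids.ModelFrobenioidBiratNormalized
import Literature.AlgebraicGeometry.Frobenioids.PadicFrobenioidIsFrobenioid
import Literature.AlgebraicGeometry.Frobenioids.RlfStructure
import HarnessLib

/-!
# Frobenioids I, Prop. 5.5 (iii): "`C^rlf` [is] always of model type" — the slot `Prop55iii_rlf_model` PROVED

Mochizuki, *The geometry of Frobenioids I*, Kyushu J. Math. **62** (2008), Prop. 5.5 (iii), kurims p. 104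
l. 37 ("Moreover, `C^un-tr`, `C^rlf` are always of model type"), proof p. 105 ll. 9–11 ("`C^un-tr`, `C^rlf`
are of model type [cf. Theorem 5.1, (iv); Proposition 5.3], hence, in particular, of isotropic and
birationally Frobenius-normalized type") [cite: MochizukiFrdI2008, Prop. 5.5 (iii) p.104]; Thm. 5.2 (ii)
p. 101 (model Frobenioids are of model type).

PROOF-ONLY closer of the named statement `FrdI.Prop55Sub.Prop55iii_rlf_model F hΦ` of the Prop. 5.5 sub-DAG
statements file (`Prop55Sub.lean`, seat abc-iut-w4-d084; plan/L1/SUBDAG-FrdI-Thm51iv-Prop55.md row P55-L05,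
`C^rlf` half, assigned to abc-iut-L1-d2 by L1-lead R77 (4) / R78 (6)).  THE realification
`C^rlf = rlf F hΦ` (`FrobenioidRealificationCanonical.lean`) IS, by construction, the model Frobenioid
(Thm. 5.2) of the data `(Φ^rlf, ℝ · Φ^birat, ℝ · Φ^birat ↪ (Φ^rlf)^gp)` with structure functor
`rlfToElem F hΦ = ModelFrobenioid.toElem _ _ _`; `Φ^rlf` is (objectwise) divisorial (`IsPerfFactorial.Rlf.isDivisorial`,
seat abc-iut-L1-d2 gen 0) and `ℝ · Φ^birat` is group-like (a subfunctor of GROUPS).  Hence Thm. 5.2 (ii) for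
model Frobenioids applies verbatim: pre-model type by `ModelFrobenioid.isOfPreModelType_of_isDivisorial`
(seat abc-iut-L6-t9/L1-t12 lineage, `ModelFrobenioidBaseSectionSkeleton.lean`) and birationally
Frobenius-normalized type by `ModelFrobenioid.isOfBiratFrobeniusNormalizedType_of_isDivisorial`
(`ModelFrobenioidBiratNormalized.lean`).  The slot's hypotheses "`C` a Frobenioid of Frobenius-isotropic and
Frobenius-normalized type" are not needed for this half (they matter for `C^un-tr`); the slot's `hR`
("`C^rlf → F_{Φ^rlf}` is a Frobenioid", needed to FORM `(C^rlf)^birat`) is used as given.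
Seat abc-iut-L1-d2 (cell abc-iut); sub-DAG row FrdI:Prop5.5(iii)/P55-L05 (rlf half).
-/

noncomputable section

namespace Literature.AlgebraicGeometry.Frobenioids

open CategoryTheory Opposite Literature.AnabelianGeometry.EtaleTheta

universe w v v' u u'

namespace RealificationData

variable {D : Type u} [Category.{v} D] {Φ : Dᵒᵖ ⥤ CommMonCat.{w}} (R : RealificationData Φ)
  (Ψ : GpSubfunctor Φ)

/-- `ℝ · Ψ` is (objectwise) group-like: every element of the subgroup `ℝ · Ψ(A) ⊆ (Φ^rlf)^gp(A)` is a unit.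
[cite: MochizukiFrdI2008, Prop. 5.3 p.103] -/
theorem realSpan_toMonoid_isGroupLike : Objectwise (fun M _ => IsGroupLike M) (R.realSpan Ψ).toMonoid :=
  fun X => isGroupLike_of_forall_isUnit ((R.realSpan Ψ).isUnit_toMonoid (op X))

/-- For THE realification data, `Φ^rlf` is (objectwise) divisorial ([FrdI] Def. 2.4 (i): `M^rlf` is
divisorial, `IsPerfFactorial.Rlf.isDivisorial`). [cite: MochizukiFrdI2008, Def. 2.4(i) p.48] -/
theorem canonical_rlf_isDivisorial (hΦ : ∀ X : Dᵒᵖ, IsPerfFactorial (Φ.obj X)) :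
    Objectwise (fun M _ => IsDivisorial M) (canonical Φ hΦ).rlf :=
  fun X => IsPerfFactorial.Rlf.isDivisorial (hΦ (op X))

/-- **THE realified model Frobenioid `R.RlfModelOf Ψ` (the model Frobenioid of `(Φ^rlf, ℝ · Ψ)`) is of
pre-model type** whenever `Φ^rlf` is objectwise divisorial (Thm. 5.2 (ii) for model Frobenioids).
[cite: MochizukiFrdI2008, Thm. 5.2 (ii) p.101] -/
theorem rlfModelOf_isOfPreModelType (hR : Objectwise (fun M _ => IsDivisorial M) R.rlf) :
    PreFrobenioid.IsOfPreModelType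
      (ModelFrobenioid.toElem R.rlf (R.realSpan Ψ).toMonoid (R.realSpan Ψ).incl) :=
  ModelFrobenioid.isOfPreModelType_of_isDivisorial hR (R.realSpan_toMonoid_isGroupLike Ψ)

/-- **THE realified model Frobenioid is of birationally Frobenius-normalized type** (given that its structure
functor is a Frobenioid, to form THE birationalization; Thm. 5.2 (ii) for model Frobenioids).
[cite: MochizukiFrdI2008, Thm. 5.2 (ii) p.101] -/
theorem rlfModelOf_isOfBiratFrobeniusNormalizedType (hR : Objectwise (fun M _ => IsDivisorial M) R.rlf)
    (hF : PreFrobenioid.IsFrobenioid (ModelFrobenioid.toElem R.rlf (R.realSpan Ψ).toMonoid (R.realSpan Ψ).incl))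
    (hsq : PreFrobenioid.HasBiratSquares
      (ModelFrobenioid.toElem R.rlf (R.realSpan Ψ).toMonoid (R.realSpan Ψ).incl)) :
    PreFrobenioidData.IsOfBiratFrobeniusNormalizedType (PreFrobenioid.biratData hF hsq) :=
  ModelFrobenioid.isOfBiratFrobeniusNormalizedType_of_isDivisorial hF hsq hR (R.realSpan_toMonoid_isGroupLike Ψ)

end RealificationData

namespace PreFrobenioid

variable {D : Type u} [Category.{v} D] {Φ : Dᵒᵖ ⥤ CommMonCat.{w}}
  {C : Type u'} [Category.{v'} C] (F : C ⥤ ElemFrobenioid Φ) (hΦ : IsPerfFactorialOn Φ)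

/-- **THE realification `C^rlf` is of pre-model type** (for any pre-Frobenioid structure `F : C → F_Φ`,
`Φ` perf-factorial: `C^rlf` is the model Frobenioid of `(Φ^rlf, ℝ · Φ^birat)`, Prop. 5.3, and model
Frobenioids with divisorial divisor monoid and group-like `B` are of pre-model type, Thm. 5.2 (ii)).
[cite: MochizukiFrdI2008, Prop. 5.5 (iii) p.104] -/
theorem rlf_isOfPreModelType : IsOfPreModelType (rlfToElem F hΦ) :=
  RealificationData.rlfModelOf_isOfPreModelType _ _
    (RealificationData.canonical_rlf_isDivisorial (IsPerfFactorialOn.op hΦ))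

/-- **THE realification `C^rlf` is of birationally Frobenius-normalized type**, given that
`C^rlf → F_{Φ^rlf}` is a Frobenioid (to form `(C^rlf)^birat`). [cite: MochizukiFrdI2008, Prop. 5.5 (iii) p.104] -/
theorem rlf_isOfBiratFrobeniusNormalizedType (hR : IsFrobenioid (rlfToElem F hΦ)) :
    PreFrobenioidData.IsOfBiratFrobeniusNormalizedType
      (biratData hR (hasBiratSquares_of_isFrobenioid hR)) :=
  RealificationData.rlfModelOf_isOfBiratFrobeniusNormalizedType _ _
    (RealificationData.canonical_rlf_isDivisorial (IsPerfFactorialOn.op hΦ)) hR _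

/-- **Prop. 5.5 (iii), `C^rlf` half of row P55-L05 — the slot `FrdI.Prop55Sub.Prop55iii_rlf_model F hΦ`
PROVED** ("`C^rlf` [is] always of model type … hence of isotropic and birationally Frobenius-normalized
type"). [cite: MochizukiFrdI2008, Prop. 5.5 (iii) p.104] -/
theorem prop55iii_rlf_model_holds : FrdI.Prop55Sub.Prop55iii_rlf_model F hΦ :=
  fun _ _ _ => ⟨rlf_isOfPreModelType F hΦ, fun hR => rlf_isOfBiratFrobeniusNormalizedType F hΦ hR⟩

end PreFrobenioid

end Literature.AlgebraicGeometry.Frobenioids
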